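import Summits.HubbardSuperconductivity.HubbardSuperconductivity.Theorems.AnisotropyChordTransferFibre3N1RowCellSoundS
import Summits.HubbardSuperconductivity.HubbardSuperconductivity.Theorems.AnisotropyChordTransferFibre3FinN1CellSound
import Summits.HubbardSuperconductivity.HubbardSuperconductivity.Theorems.AnisotropyChordTransferFibre3L2TCell

/-!
# Route `AnisotropyChord` / H0 rotor rung, LEVEL 2 row `N₁` on the t-BLOCKS `L₀ ≤ L ≤ L₁`: ★★★ a passing cell check on a
block cell bounds the trial gap for EVERY `L` of the block

The `∀ L ≥ 128` row-`N₁` certificate (`…N1RowCellSound`, `…N1RowCellSoundS`: `trialGap_of_cellCheck`, `trialGap_of_coreBound`)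
is phrased through `c : L2.NamedCell` (box slot 0 = `[0, θ²(128)]`, brackets at `K = 32`).  For the t-blocks of the range
`48 ≤ L < 128` (route-lead ruling R1) the block cell `L2.TCell` (`…Fibre3L2TCell`: `L₀`, `L₁`, t-slot, brackets at `K = L₀/4`)
replaces it; the RExpr program is unchanged and runs on the block box through p3's Box-generic checker `n1CellCheckCB`
(`…FinN1CellSound`).  This file is the block analogue of the two soundness files:
* `CoreBoundB B cmin` — the core bound (conclusion of the interval layer) on a base box `B`; `coreBoundB_of_checkCB`
  (zero order, from `n1CellCheckCB_sound`);
* `Gzero_pos_of_lt` (`G̃_λ(0) > 0` for `λ < 2ε₁`, termwise) — replaces the `L ≥ 128` regime input `manifold_band` in the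
  positivity `c_s·G̃_λ(0) > 0`, so that NO `L ≥ 128` fact is used: the regime needs only `16 ≤ L`;
* ★ `pmem_xTrueT` — the true vector is a prefix-member of the block box (`TCell.point_mem_box`);
* ★★★ `trialGap_of_coreBoundT`: a core bound on the block box + `c.check` ⟹ for every `L` with `c.L₀ ≤ L` (`≤ c.L₁`),
  `16 ≤ L`, every ground profile with `(ν, a)` in the cell: `cmin · U ≤ N₁` — verbatim the argument of `trialGap_of_coreBound`;
* ★★★ `trialGap_of_cellCheckT`: the zero-order kernel form (`n1CellCheckCB (c.box a₁ a₂) 2 cmin pi = true`).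
The first-order (slope) form lands separately (Box-level `EndHolds`/`finalCheckB` chain ⟹ `CoreBoundB`).
Prover seat `hubbard-h0-rotor-p2` g8; helper for piece A = stmt-HubbardSuperconductivity-23918 of rung 19089
(`--supports`, helper class).  WHAT THIS IS NOT: nothing here proves superconductivity in the Hubbard model; it reduces the
(KT-1″) trial-gap bound on a t-block to kernel cell checks — helper lemmas of ONE conditional reduction (the GM₃ ∀L
certificate); the rotor TARGET as originally worded stays FALSE (g15 verdict).  Mathlib + the tree only; no sorry.
-/

set_option linter.dupNamespace false
set_option autoImplicit false

open scoped BigOperators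
open Literature.Analysis.ValidatedNumerics

namespace Summit.HubbardSuperconductivity.HubbardSuperconductivity.Theorems.AnisotropyChord.Transfer.Fibre3.L2.N1

open Summit.HubbardSuperconductivity.HubbardSuperconductivity.Theorems.AnisotropyChord.Transfer.Fibre3.L2

/-! ## The core bound on a base box -/

/-- ★ THE CORE BOUND on a base box `B` (sixteen slots + whatever the caller stages): the conclusion of the interval layer
(`n1CellCheckCB_sound` / the first-order chain) for the constant `cmin` (block size `M₂ = 2`). -/
def CoreBoundB (B : Box) (cmin : ℚ) : Prop :=
  ∀ (X : ℕ → ℝ), PMem B X →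
    (∀ j (hj : j < (specs 2).length), ((specs 2)[j].1).eval X ≤ X (16 + j) ∧ X (16 + j) ≤ ((specs 2)[j].2).eval X) →
    ∀ (vs : List ℝ), vs.length = 5 →
    (∀ j (hj : j < (objSpecsC 2).length) (hj' : j < vs.length),
      ((objSpecsC 2)[j].1).eval X ≤ vs[j] ∧ vs[j] ≤ ((objSpecsC 2)[j].2).eval X) →
    1 ≤ finalVec X vs 6 ∧ 1 ≤ UpE.eval (finalVec X vs) ∧ (cmin : ℝ) * UpE.eval (finalVec X vs) ≤ N1pE.eval (finalVec X vs)

/-- p2's `CoreBound c a₁ a₂` is the base-box core bound on `c.box a₁ a₂`. [folklore] -/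
theorem coreBound_iff_coreBoundB (c : L2.NamedCell) (a1 a2 cmin : ℚ) :
    CoreBound c a1 a2 cmin ↔ CoreBoundB (c.box a1 a2) cmin := Iff.rfl

/-- ★ the zero-order Box-generic checker gives the core bound. -/
theorem coreBoundB_of_checkCB {B : Box} (hB16 : B.length = 16) {cmin : ℚ} {pi : ℕ × ℕ}
    (hchk : n1CellCheckCB B 2 cmin pi = true) : CoreBoundB B cmin :=
  fun X hX hsp vs hvl hob => n1CellCheckCB_sound B hB16 2 cmin pi hchk specsVarsOkC_two X hX hsp vs hvl hob

/-! ## Regime: positivity of the capacity below the pair spectrum -/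

variable (L : ℕ) [NeZero L]

/-- `G̃_λ(0) = V⁻¹ Σ_{k ≠ 0} (2ε(k) − λ)⁻¹ > 0` for `λ < 2ε₁` (every term is positive; `L ≥ 2`). [folklore] -/
theorem Gzero_pos_of_lt (hL : 2 ≤ L) {lam2 : ℝ} (h : lam2 < 2 * eps1 L) : 0 < Gzero L lam2 := by
  classical
  unfold Gzero
  have hLpos : (0 : ℝ) < L := by exact_mod_cast (show 0 < L by omega)
  apply div_pos _ (by positivity)
  apply Finset.sum_pos
  · intro k hk
    have hk0 : k ≠ 0 := (Finset.mem_erase.mp hk).1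
    have hε := eps1_le_epsT L hL hk0
    have : 0 < 2 * epsT L k - lam2 := by linarith
    positivity
  · refine ⟨K1 L, Finset.mem_erase.mpr ⟨?_, Finset.mem_univ _⟩⟩
    intro hK
    have h1 : ((1 : ZMod L)) = 0 := by
      have := congrArg Prod.fst hK
      simpa [K1] using this
    have hL1 : 1 < L := by omega
    haveI : Fact (1 < L) := ⟨hL1⟩
    exact one_ne_zero h1

/-! ## The true vector lies in the block box -/

/-- ★ the true vector is a prefix-member of the block cell box (`c.L₀ ≤ L ≤ c.L₁`, `(ν, a)` in the cell, the cell's kernel facts). -/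
theorem pmem_xTrueT (c : L2.TCell) (hc : c.check = true) (a1 a2 : ℚ) (hL : c.L0 ≤ L) (hL1 : c.L1 = 0 ∨ L ≤ c.L1)
    (Δ lam2 : ℝ) (f : Tor L → ℝ) (a : ℝ)
    (hν1 : (c.n1 : ℝ) / c.νd ≤ lam2 / (2 * Real.pi / L) ^ 2) (hν2 : lam2 / (2 * Real.pi / L) ^ 2 ≤ (c.n2 : ℝ) / c.νd)
    (ha1 : ((a1 : ℚ) : ℝ) ≤ a) (ha2 : a ≤ ((a2 : ℚ) : ℝ)) :
    PMem (c.box a1 a2) (xTrue L Δ lam2 f a) := by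
  intro i hi
  rw [c.box_length a1 a2] at hi
  have hm := L2.TCell.point_mem_box c hc a1 a2 L hL hL1 lam2 a hν1 hν2 ha1 ha2 i
  rw [xTrue_lt16 L Δ lam2 f a hi]
  exact hm

/-! ## ★★★ The block cell certificate -/

/-- ★★★ **A CORE BOUND ON A BLOCK CELL GIVES THE TRIAL-GAP BOUND FOR EVERY `L` OF THE BLOCK** (`c.L₀ ≤ L`, `L ≤ c.L₁`
unless `c.L₁ = 0`, `16 ≤ L`; ground profile with `0 ≤ Δ < 1`, `ν = λ₂/θ²` in the cell, `a = Δf(x̂) ∈ [a₁, a₂]`):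
`cmin · U ≤ N₁`.  The argument of `trialGap_of_coreBound` with the block box bridge and the `L`-free regime. -/
theorem trialGap_of_coreBoundT (c : L2.TCell) (a1 a2 cmin : ℚ)
    (hcore : CoreBoundB (c.box a1 a2) cmin) (hc : c.check = true) (h16 : 16 ≤ L) (hL : c.L0 ≤ L)
    (hL1 : c.L1 = 0 ∨ L ≤ c.L1)
    {Δ lam2 : ℝ} {f : Tor L → ℝ} (hΔ0 : 0 ≤ Δ) (hΔ1 : Δ < 1) (hf : IsGroundTwoMagnon L Δ lam2 f)
    (hν1 : (c.n1 : ℝ) / c.νd ≤ lam2 / (2 * Real.pi / L) ^ 2) (hν2 : lam2 / (2 * Real.pi / L) ^ 2 ≤ (c.n2 : ℝ) / c.νd)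
    (ha1 : ((a1 : ℚ) : ℝ) ≤ Δ * f (K1 L)) (ha2 : Δ * f (K1 L) ≤ ((a2 : ℚ) : ℝ)) :
    (cmin : ℝ) * Uunit L Δ f ≤ trialGapN1 L Δ f := by
  classical
  set X := xTrue L Δ lam2 f (Δ * f (K1 L)) with hXdef
  set θ : ℝ := 2 * Real.pi / L with hθ
  have hLpos : (0 : ℝ) < L := by exact_mod_cast (show 0 < L by omega)
  have hπ := Real.pi_pos
  have hθpos : 0 < θ := by positivity
  have ht0 : 0 < θ ^ 2 := by positivity
  -- regime facts (no `L ≥ 128` input)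
  have hlam : 0 < lam2 := lam2_pos L (by omega) hΔ1 hf.1
  have h2 : 2 * lam2 < eps1 L := two_lam2_lt_eps1 L (by omega) hΔ0 hf
  have ha0 : 0 ≤ Δ * f (K1 L) := mul_nonneg hΔ0 (le_of_lt hf.1.2.2.1)
  have hν4 : lam2 / (2 * Real.pi / L) ^ 2 < 4 / Real.pi ^ 2 := by
    -- `λ₂ < ε₁/2 ≤ θ²/4`, so `ν < 1/4 < 4/π²`
    have hε := RateLemma.eps1_le_half_theta_sq L
    rw [div_lt_div_iff₀ ht0 (by positivity)]
    have hπ2 : Real.pi ^ 2 < 16 := by nlinarith [Real.pi_lt_d2, Real.pi_pos]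
    rw [← hθ] at hε
    nlinarith
  obtain ⟨_, d2, d3, _, d5, _, d7⟩ := ManifoldA.manifold_dictionary L (by omega) hΔ0 hΔ1 hf
  have hu : 0 < cS L Δ lam2 f * Gzero L lam2 := by
    have hη : 0 < etaEff L lam2 := by unfold etaEff; positivity
    have hcS : 0 < cS L Δ lam2 f := by rw [d2]; positivity
    exact mul_pos hcS (Gzero_pos_of_lt L (by omega) (by linarith))
  have hV1 : (1 : ℝ) / (L : ℝ) ^ 2 = θ ^ 2 * (4 * Real.pi ^ 2)⁻¹ := by
    rw [hθ]; field_simp; ring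
  have hu' : 0 < 1 - Δ * f (K1 L) + Δ * f (K1 L) * ((2 * Real.pi / L) ^ 2 * (4 * Real.pi ^ 2)⁻¹) := by
    have e : 1 - Δ * f (K1 L) + Δ * f (K1 L) * ((2 * Real.pi / L) ^ 2 * (4 * Real.pi ^ 2)⁻¹)
        = 1 - Δ * f (K1 L) + Δ * f (K1 L) / (L : ℝ) ^ 2 := by
      rw [← hθ, ← hV1]; ring
    rw [e, ← d5, Gres_zero_zero_eq_Gzero]; exact hu
  -- the interval layer
  have hPM : PMem (c.box a1 a2) X := pmem_xTrueT L c hc a1 a2 hL hL1 Δ lam2 f _ hν1 hν2 ha1 ha2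
  have hsp := xTrue_specs_ground L Δ lam2 f (by omega) hΔ0 hΔ1 hf hlam h2 hν4 ha0 hu'
  set vB : ℝ := ((2 * Real.pi / L) ^ 2) ^ 3 * ∑ k : Tor L, F2 L f k ^ 2 * F2 L f (k + K1 L) with hvB
  set vP : ℝ := ((2 * Real.pi / L) ^ 2) ^ 3 * ∑ k : Tor L, F2 L f k ^ 3 with hvP
  set vA : ℝ := ((2 * Real.pi / L) ^ 2) ^ 2 * ∑ k : Tor L, F2 L f k ^ 2 * cosx L k with hvA
  set vQ : ℝ := ((2 * Real.pi / L) ^ 2) ^ 2 * ∑ k : Tor L, nK L f k * F2 L f k with hvQ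
  set vJ : ℝ := ((2 * Real.pi / L) ^ 2) ^ 2 * ∑ k : Tor L, bcJ L f k with hvJ
  have oB := bHat_mem L Δ lam2 f (by omega) hΔ0 hΔ1 hf hlam h2 hu
  have oP := pHat_mem L Δ lam2 f (by omega) hΔ0 hΔ1 hf hlam h2 hu
  have oA := aHat_mem L Δ lam2 f (by omega) hΔ0 hΔ1 hf hlam h2 hu
  have oQ := q1Hat_mem L Δ lam2 f (by omega) hΔ0 hΔ1 hf hlam h2 hu
  have oJ := j1Hat_mem L Δ lam2 f (by omega) hΔ0 hΔ1 hf hlam h2 hu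
  have hob : ∀ j (hj : j < (objSpecsC 2).length) (hj' : j < [vB, vP, vA, vQ, vJ].length),
      ((objSpecsC 2)[j].1).eval X ≤ [vB, vP, vA, vQ, vJ][j] ∧ [vB, vP, vA, vQ, vJ][j] ≤ ((objSpecsC 2)[j].2).eval X := by
    intro j hj hj'
    have hj5 : j < 5 := by simpa [objSpecsC] using hj
    interval_cases j
    · simpa [objSpecsC] using oB
    · simpa [objSpecsC] using oP
    · simpa [objSpecsC] using oA
    · simpa [objSpecsC] using oQ
    · simpa [objSpecsC] using oJ
  obtain ⟨hP1, hU1, hM⟩ := hcore X hPM hsp [vB, vP, vA, vQ, vJ] rfl hob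
  obtain ⟨y0, y1, y2, y3, y4, y5, y6, y7, y8, y9⟩ := finalVec_vals X vB vP vA vQ vJ
  set y := finalVec X [vB, vP, vA, vQ, vJ] with hy
  -- coordinates of `X`
  have hX0 : X 0 = θ ^ 2 := xTrue_zero L Δ lam2 f _
  have hX1 : X 1 = Real.pi ^ 2 := by rw [hXdef, xTrue_lt16 L Δ lam2 f _ (by norm_num)]; rfl
  have hX2 : X 2 = lam2 / θ ^ 2 := by rw [hXdef, xTrue_lt16 L Δ lam2 f _ (by norm_num)]; rfl
  have hX3 : X 3 = Δ * f (K1 L) := by rw [hXdef, xTrue_lt16 L Δ lam2 f _ (by norm_num)]; rfl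
  have hX16 : X 16 = eps1 L / θ ^ 2 := by rw [hXdef, xTrue_16]; rfl
  rw [y6] at hP1
  have hvP0 : 0 < vP := by linarith
  -- the assembly expressions at `y`
  have eN : N1pE.eval y = -(6 * y 4 * y 5) + 9 * y 8 * y 5 * (y 6)⁻¹
      - 1 / 2 * y 4 * y 0 * (3 * y 2 * y 6 + -(3 / 2 * y 8) + 12 * (y 3 * (y 3 + y 1 * y 2)) * y 7) - 3 * y 9 := by
    simp only [N1pE, rsum, RExpr.eval, cst, fE1, fB, fQ, fP, fT, fNu, fA, fPi2, fAx, fJ]; push_cast; ring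
  have eU : UpE.eval y = 192 * (y 1) ^ 3 * (3 * y 2 - 3 / 2 * y 8 * (y 6)⁻¹) := by
    simp only [UpE, cube, RExpr.eval, cst, fPi2, fNu, fQ, fP]; push_cast; ring
  -- the true `N₁` and `U`
  have heven : ∀ r : Tor L, f (-r) = f r := hf.2.1
  have hswap : ∀ r : Tor L, f (r.2, r.1) = f r := ground_swap L (by omega) hf
  have hN1 := n1Identity_holds L Δ lam2 f hf.1
  have hG2 := g2OneLoopForm_holds L (by omega) Δ lam2 f hf.1 heven hswap
  have hQP := sum_piR_C0fn L hf.1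
  have hPf := piNormOneLoop_holds L f heven
  have hBf := btermOneLoop_holds L f heven
  have hAf := axhatOneLoop_holds L f heven
  have hQf := piC0OneLoop_holds L Δ lam2 f hf.1 heven
  have hCf := bcOneLoop_holds L Δ lam2 f hf.1 heven
  rw [nn_sum_swap] at hQf hCf
  -- express everything through the hatted values
  have hV : ((L : ℝ) ^ 2) = 4 * Real.pi ^ 2 / θ ^ 2 := by rw [hθ]; field_simp; ring
  have eP : PiNormSq L f = vP / (θ ^ 4 * (4 * Real.pi ^ 2)) := by
    rw [hPf, hvP, hV, ← hθ]; field_simp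
  have eB : Bterm L f = 6 * vB / (θ ^ 4 * (4 * Real.pi ^ 2)) := by
    rw [hBf, hvB, hV, ← hθ]; field_simp
  have eA : Axhat L f = vA / (θ ^ 2 * (4 * Real.pi ^ 2)) := by
    rw [hAf, hvA, hV, ← hθ]; unfold cosx; field_simp
  have eQ : ∑ cc : Cfg L, piR L f cc * C0fn L Δ lam2 f cc = -(3 / 2) * vQ / (θ ^ 2 * (4 * Real.pi ^ 2)) := by
    rw [hQf, hvQ, hV, ← hθ]; unfold nK
    simp only [List.sum_map_mul_right]
    field_simp
  have eC : BCterm L Δ lam2 f = -3 * vJ / (θ ^ 2 * (4 * Real.pi ^ 2)) := by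
    rw [hCf, hvJ, hV, ← hθ]; unfold bcJ bcSummand; field_simp
  have hPpos : 0 < PiNormSq L f := by rw [eP]; positivity
  have hT : Tplus L Δ f = 3 * lam2 + (∑ cc : Cfg L, piR L f cc * C0fn L Δ lam2 f cc) / PiNormSq L f := by
    rw [hQP]; field_simp; ring
  have hNval : trialGapN1 L Δ f = N1pE.eval y / (4 * Real.pi ^ 2 * θ ^ 2) := by
    rw [eN, y0, y1, y2, y3, y4, y5, y6, y7, y8, y9, hX0, hX1, hX2, hX3, hX16, ← d7, ← d3, hN1, hG2, hT, eQ, eP, eB, eA, eC]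
    field_simp
    ring
  have hUval : Uunit L Δ f = UpE.eval y / (4 * Real.pi ^ 2 * θ ^ 2) := by
    unfold Uunit
    rw [eU, y1, y2, y6, y8, hX1, hX2, hT, eQ, eP, hV]
    field_simp
    ring
  rw [hNval, hUval, mul_div_assoc']
  exact div_le_div_of_nonneg_right hM (by positivity)

/-- ★★★ **THE ZERO-ORDER BLOCK CELL CERTIFICATE**: `n1CellCheckCB (c.box a₁ a₂) 2 cmin pi = true` and `c.check = true` ⟹ for
every `L` of the block (`c.L₀ ≤ L`, `L ≤ c.L₁` unless `c.L₁ = 0`, `16 ≤ L`) and every ground profile with `(ν, a)` in the cell: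
`cmin · U ≤ N₁`. -/
theorem trialGap_of_cellCheckT (c : L2.TCell) (a1 a2 cmin : ℚ) (pi : ℕ × ℕ)
    (hchk : n1CellCheckCB (c.box a1 a2) 2 cmin pi = true) (hc : c.check = true) (h16 : 16 ≤ L) (hL : c.L0 ≤ L)
    (hL1 : c.L1 = 0 ∨ L ≤ c.L1)
    {Δ lam2 : ℝ} {f : Tor L → ℝ} (hΔ0 : 0 ≤ Δ) (hΔ1 : Δ < 1) (hf : IsGroundTwoMagnon L Δ lam2 f)
    (hν1 : (c.n1 : ℝ) / c.νd ≤ lam2 / (2 * Real.pi / L) ^ 2) (hν2 : lam2 / (2 * Real.pi / L) ^ 2 ≤ (c.n2 : ℝ) / c.νd)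
    (ha1 : ((a1 : ℚ) : ℝ) ≤ Δ * f (K1 L)) (ha2 : Δ * f (K1 L) ≤ ((a2 : ℚ) : ℝ)) :
    (cmin : ℝ) * Uunit L Δ f ≤ trialGapN1 L Δ f :=
  trialGap_of_coreBoundT L c a1 a2 cmin (coreBoundB_of_checkCB (c.box_length a1 a2) hchk) hc h16 hL hL1 hΔ0 hΔ1 hf
    hν1 hν2 ha1 ha2

end Summit.HubbardSuperconductivity.HubbardSuperconductivity.Theorems.AnisotropyChord.Transfer.Fibre3.L2.N1
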